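import Literature.AlgebraicGeometry.Frobenioids.UnitTrivializationFunctor
import Literature.AlgebraicGeometry.Frobenioids.GroupSubfunctors
import Literature.AlgebraicGeometry.Frobenioids.ModelFrobenioidIsFrobenioid
import Literature.AlgebraicGeometry.Frobenioids.ModelFrobenioidStandard
import HarnessLib

/-!
# Frobenioids I, Proposition 5.5 (iv): the unit-trivialization of a model Frobenioid is the model
# Frobenioid of `(Φ, Φ^birat ↪ Φ^gp)`

Mochizuki, *The geometry of Frobenioids I: the general theory*, Kyushu J. Math. **62** (2008)
293–400, §5, Proposition 5.5 (iv), kurims text p. 104 ll. 40–44, proof p. 105 ll. 26–27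
[cite: MochizukiFrdI2008, Prop. 5.5 (iv) p.104]:

  "(iv) If `C` is the model Frobenioid associated to data `Φ`, `B`, `Div_B : B → Φ^gp` as in
  Theorem 5.2, and `Φ^birat ⊆ Φ^gp` is the image of `Div_B`, then there is a natural equivalence of
  categories between … `C^un-tr` … and the model Frobenioid associated to the data …
  `Φ, Φ^birat, Φ^birat ↪ Φ^gp` …" — "assertion (iv) follows immediately from the definitions".

PROVED here (sub-node `FrdI:Prop5.5(iv)/P55-L08`, row `Prop55iv_untr` of seat abc-iut-w4-d084's
`Prop55Sub.lean`; this piece abc-iut-L1-t2, the seat of Thm. 5.2 (i) `ModelFrobenioid`).  For THE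
unit-trivialization `C^un-tr = C^istr/≈^{O^×}` of Def. 3.1 (iv) (seat abc-iut-L1-t3's
`PreFrobenioidData.Untr`, with seat abc-iut-L1-d5's structure functor `untrFunctor : C^un-tr → F_Φ` of
Prop. 3.3 (iv)) of the model Frobenioid `C` of `(Φ, B, Div_B)` (every object of which is isotropic,
Thm. 5.2 (ii)), and for ANY subfunctor of groups `Ψ ⊆ Φ^gp` whose value at each `A ∈ Ob(D)` is the image
of `Div_B` (hypothesis `IsImageOfDivB`; seat abc-iut-L1-t5's `GpSubfunctor`, model Frobenioid
`Ψ.ModelOf` of `(Φ, Ψ, Ψ ↪ Φ^gp)`):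
* the functor `C^istr → Ψ.ModelOf`, `(A_D, α) ↦ (A_D, α)`, `(d, f, Div, u) ↦ (d, f, Div, Div_B(u))`
  (`untrCompareAux`) identifies exactly the unit-equivalent arrows — by Prop. 3.3 (ii) in the form
  `toUntr_map_eq_iff` (two arrows of `C^istr` have the same class in `C^un-tr` iff they have the same
  image `(Base, Div, deg_Fr)` in `F_Φ`) and because `Div_B(u)` is determined by `(Base, Div, deg_Fr)`
  through relation (d) of Thm. 5.2 (i) — so it descends to a faithful functor
  `untrCompare : C^un-tr → Ψ.ModelOf`;
* `untrCompare` is full (lift `w ∈ Ψ(A) = Div_B(B(A))` to some `u`) and surjective on objects, hence an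
  equivalence (`untrCompare_isEquivalence`), and `untrCompare ⋙ (Ψ.ModelOf → F_Φ) = (C^un-tr → F_Φ)`
  ON THE NOSE (`untrCompare_comp_toElem`);
* packaged as print's "natural equivalence … compatible with the functors to `F_Φ`":
  `nonempty_untr_equivalence_modelOf`, and at the image of `Div_B` itself
  `nonempty_untr_equivalence_image`.
Hypotheses: `C → F_Φ` a Frobenioid (`hF`, Thm. 5.2 (ii), seat abc-iut-found — needed for Prop. 3.3 (ii))
and `B` group-like (`hBg`, standing hypothesis of Thm. 5.2 — every object is then isotropic).
Composition is diagrammatic; monoids multiplicative.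
-/

namespace Literature.AlgebraicGeometry.Frobenioids

open CategoryTheory Opposite

universe w v u

namespace ModelFrobenioid

variable {D : Type u} [Category.{v} D] {Φ B : Dᵒᵖ ⥤ CommMonCat.{w}} {DivB : B ⟶ monoidGp Φ}

/-! ### Bookkeeping on the model Frobenioid `Ψ.ModelOf` of a subfunctor of groups `Ψ ⊆ Φ^gp` -/

/-- `Div_B` of the model Frobenioid of `(Φ, Ψ, Ψ ↪ Φ^gp)` is the inclusion `Ψ(A) ⊆ Φ(A)^gp`.
[cite: MochizukiFrdI2008, Prop. 5.5 (iv) p.104] -/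
@[simp] theorem divB_incl (Ψ : GpSubfunctor Φ) (X : D) (c : Ψ.carrier X) :
    divB Φ Ψ.toMonoid Ψ.incl (op X) c = c.1 := rfl

/-- The transport of `Ψ.ModelOf`'s rational function monoid is `Φ(f)` on `Φ^gp`.
[cite: MochizukiFrdI2008, Prop. 5.5 (iv) p.104] -/
@[simp] theorem coe_toMonoid_map (Ψ : GpSubfunctor Φ) {X X' : D} (f : X' ⟶ X) (c : Ψ.carrier X) :
    ((Ψ.toMonoid.map f.op).hom c).1 = pullGp Φ f c.1 := rfl

/-- In a model Frobenioid the image `Div_B(u_φ)` of the unit component of a morphism is determined by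
`(deg_Fr(φ), Base(φ), Div(φ))` through relation (d) of Thm. 5.2 (i).
[cite: MochizukiFrdI2008, Thm. 5.2(i) p.100] -/
theorem divB_unit_eq {X Y : ModelFrobenioid Φ B DivB} (φ : X ⟶ Y) :
    divB Φ B DivB (op X.base) (unit φ) =
      (pullGp Φ (baseMap φ) Y.cls)⁻¹ * (X.cls ^ (degFr φ : ℕ) * Algebra.GrothendieckGroup.of (div φ)) := by
  rw [rel φ, ← mul_assoc, inv_mul_cancel, one_mul]

/-- Two morphisms of a model Frobenioid with the same image in `F_Φ` (same Frobenius degree, base and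
zero divisor) have the same `Div_B(u)`. [cite: MochizukiFrdI2008, Thm. 5.2(i) p.100] -/
theorem divB_unit_eq_of_eq {X Y : ModelFrobenioid Φ B DivB} {φ ψ : X ⟶ Y} (hd : degFr φ = degFr ψ)
    (hb : baseMap φ = baseMap ψ) (hdiv : div φ = div ψ) :
    divB Φ B DivB (op X.base) (unit φ) = divB Φ B DivB (op X.base) (unit ψ) := by
  rw [divB_unit_eq, divB_unit_eq, hd, hb, hdiv]

variable (Φ B DivB) in
/-- The hypothesis "`Ψ ⊆ Φ^gp` is the image of `Div_B`" of Prop. 5.5 (iv) ("`Φ^birat ⊆ Φ^gp` is the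
image of `Div_B`"), for a subfunctor of groups `Ψ`. [cite: MochizukiFrdI2008, Prop. 5.5 (iv) p.104] -/
def IsImageOfDivB (Ψ : GpSubfunctor Φ) : Prop :=
  ∀ (A : D) (c : Algebra.GrothendieckGroup (Φ.obj (op A))),
    c ∈ Ψ.carrier A ↔ c ∈ biratSubmonoid Φ B DivB (op A)

section Compare

variable (Ψ : GpSubfunctor Φ)

/-! ### The comparison functor `C^istr → Ψ.ModelOf` and its descent to `C^un-tr` -/

/-- On morphisms: `(d, f, Div, u) ↦ (d, f, Div, Div_B(u))`. [cite: MochizukiFrdI2008, Prop. 5.5 (iv) p.104] -/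
noncomputable def untrCompareMap (hΨ : IsImageOfDivB Φ B DivB Ψ) {X Y : (data Φ B DivB).Istr}
    (α : X ⟶ Y) : (⟨X.obj.base, X.obj.cls⟩ : Ψ.ModelOf) ⟶ ⟨Y.obj.base, Y.obj.cls⟩ where
  degFr := (degFr α.hom :)
  base := (baseMap α.hom :)
  div := (div α.hom :)
  unit := ⟨divB Φ B DivB _ (unit α.hom :), (hΨ _ _).mpr ⟨(unit α.hom :), rfl⟩⟩
  rel := by
    rw [divB_incl]
    exact rel α.hom

/-- The functor `C^istr → Ψ.ModelOf`: `(A_D, α) ↦ (A_D, α)`, `(d, f, Div, u) ↦ (d, f, Div, Div_B(u))`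
("follows immediately from the definitions"). [cite: MochizukiFrdI2008, Prop. 5.5 (iv) p.104] -/
noncomputable def untrCompareAux (hΨ : IsImageOfDivB Φ B DivB Ψ) : (data Φ B DivB).Istr ⥤ Ψ.ModelOf where
  obj X := ⟨X.obj.base, X.obj.cls⟩
  map α := untrCompareMap Ψ hΨ α
  map_id X := by
    refine hom_ext rfl rfl rfl (Subtype.ext ?_)
    show divB Φ B DivB (op X.obj.base) (unit (𝟙 X.obj) :) = 1
    rw [unit_id, map_one]
  map_comp {X Y Z} α β := by
    refine hom_ext rfl rfl rfl (Subtype.ext ?_)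
    show divB Φ B DivB (op X.obj.base) (unit (α.hom ≫ β.hom) :) = _
    rw [unit_comp, map_mul, map_pow, ← pullGp_divB]
    rfl

/-- `untrCompareAux` identifies unit-equivalent arrows (indeed any two arrows with the same image in
`F_Φ`: Prop. 3.3 (ii), `toUntr_map_eq_iff`). [cite: MochizukiFrdI2008, Prop. 5.5 (iv) p.104] -/
theorem untrCompareAux_map_eq (hΨ : IsImageOfDivB Φ B DivB Ψ) {X Y : (data Φ B DivB).Istr}
    (α₁ α₂ : X ⟶ Y) (h : (toElem Φ B DivB).map α₁.hom = (toElem Φ B DivB).map α₂.hom) :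
    (untrCompareAux Ψ hΨ).map α₁ = (untrCompareAux Ψ hΨ).map α₂ := by
  have hd : (degFr α₁.hom :) = degFr α₂.hom := congrArg ElemFrobenioid.Hom.degFr h
  have hb : (baseMap α₁.hom :) = baseMap α₂.hom := congrArg ElemFrobenioid.Hom.base h
  have hdiv : (div α₁.hom :) = div α₂.hom := congrArg ElemFrobenioid.Hom.div h
  refine hom_ext ?_ ?_ ?_ (Subtype.ext ?_)
  · exact hd
  · exact hb
  · exact hdiv
  · exact divB_unit_eq_of_eq hd hb hdiv

/-- **The comparison functor `C^un-tr → Ψ.ModelOf`** (descent of `untrCompareAux` to the quotient by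
unit-equivalence). [cite: MochizukiFrdI2008, Prop. 5.5 (iv) p.104] -/
noncomputable def untrCompare (hF : PreFrobenioid.IsFrobenioid (toElem Φ B DivB))
    (hΨ : IsImageOfDivB Φ B DivB Ψ) : (data Φ B DivB).Untr ⥤ Ψ.ModelOf :=
  CategoryTheory.Quotient.lift _ (untrCompareAux Ψ hΨ) fun _ _ α₁ α₂ e =>
    untrCompareAux_map_eq Ψ hΨ α₁ α₂
      ((PreFrobenioid.toUntr_map_eq_iff hF α₁ α₂).mp (CategoryTheory.Quotient.sound _ e))

/-- `C^istr → C^un-tr → Ψ.ModelOf` is `untrCompareAux` (on the nose).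
[cite: MochizukiFrdI2008, Prop. 5.5 (iv) p.104] -/
theorem toUntr_comp_untrCompare (hF : PreFrobenioid.IsFrobenioid (toElem Φ B DivB)) (hΨ : IsImageOfDivB Φ B DivB Ψ) :
    (data Φ B DivB).toUntr ⋙ untrCompare Ψ hF hΨ = untrCompareAux Ψ hΨ :=
  CategoryTheory.Quotient.lift_spec _ _ _

/-- `untrCompare` on the class of an arrow of `C^istr`. [cite: MochizukiFrdI2008, Prop. 5.5 (iv) p.104] -/
theorem untrCompare_map_toUntr (hF : PreFrobenioid.IsFrobenioid (toElem Φ B DivB)) (hΨ : IsImageOfDivB Φ B DivB Ψ) {X Y : (data Φ B DivB).Istr} (α : X ⟶ Y) :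
    (untrCompare Ψ hF hΨ).map ((data Φ B DivB).toUntr.map α) = untrCompareMap Ψ hΨ α := rfl

/-! ### `untrCompare` is an equivalence compatible with the functors to `F_Φ` -/

/-- **Compatibility with the functors to `F_Φ`, on the nose**: `C^un-tr → Ψ.ModelOf → F_Φ` is the
structure functor `C^un-tr → F_Φ` of Prop. 3.3 (iv). [cite: MochizukiFrdI2008, Prop. 5.5 (iv) p.104] -/
theorem untrCompare_comp_toElem (hF : PreFrobenioid.IsFrobenioid (toElem Φ B DivB)) (hΨ : IsImageOfDivB Φ B DivB Ψ) :
    untrCompare Ψ hF hΨ ⋙ toElem Φ Ψ.toMonoid Ψ.incl = PreFrobenioid.untrFunctor hF := by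
  apply CategoryTheory.Quotient.lift_unique
  rw [← Functor.assoc, toUntr_comp_untrCompare]
  rfl

/-- `untrCompare` is faithful (Prop. 3.3 (ii): classes in `C^un-tr` are determined by their image in
`F_Φ`, which factors through `Ψ.ModelOf`). [cite: MochizukiFrdI2008, Prop. 5.5 (iv) p.104] -/
theorem untrCompare_faithful (hF : PreFrobenioid.IsFrobenioid (toElem Φ B DivB)) (hΨ : IsImageOfDivB Φ B DivB Ψ) : (untrCompare Ψ hF hΨ).Faithful := by
  refine ⟨fun {X Y} g₁ g₂ h => ?_⟩
  obtain ⟨α₁, rfl⟩ := (data Φ B DivB).toUntr.map_surjective g₁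
  obtain ⟨α₂, rfl⟩ := (data Φ B DivB).toUntr.map_surjective g₂
  refine (PreFrobenioid.toUntr_map_eq_iff hF α₁ α₂).mpr ?_
  have h' : untrCompareMap Ψ hΨ α₁ = untrCompareMap Ψ hΨ α₂ := h
  have hb := congrArg Hom.base h'
  have hdiv := congrArg Hom.div h'
  have hd := congrArg Hom.degFr h'
  exact ElemFrobenioid.Hom.ext hb hdiv hd

/-- A morphism of `Ψ.ModelOf` between objects of `C` lifts to `C`: choose `u` with `Div_B(u)` the given
element of `Ψ(A) = Div_B(B(A))`. [cite: MochizukiFrdI2008, Prop. 5.5 (iv) p.104] -/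
noncomputable def untrCompareLift (hΨ : IsImageOfDivB Φ B DivB Ψ) {X Y : ModelFrobenioid Φ B DivB}
    (ψ : (⟨X.base, X.cls⟩ : Ψ.ModelOf) ⟶ ⟨Y.base, Y.cls⟩) : X ⟶ Y where
  degFr := (Hom.degFr ψ :)
  base := (Hom.base ψ :)
  div := (Hom.div ψ :)
  unit := Classical.choose ((hΨ _ _).mp (Hom.unit ψ :).2)
  rel := by
    rw [Classical.choose_spec ((hΨ _ _).mp (Hom.unit ψ :).2)]
    exact Hom.rel ψ

/-- The lift maps back to the given morphism. [cite: MochizukiFrdI2008, Prop. 5.5 (iv) p.104] -/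
theorem untrCompareMap_lift (hΨ : IsImageOfDivB Φ B DivB Ψ) {X Y : (data Φ B DivB).Istr}
    (ψ : (⟨X.obj.base, X.obj.cls⟩ : Ψ.ModelOf) ⟶ ⟨Y.obj.base, Y.obj.cls⟩) :
    untrCompareMap Ψ hΨ (ObjectProperty.homMk (untrCompareLift Ψ hΨ (X := X.obj) (Y := Y.obj) ψ) :
      X ⟶ Y) = ψ :=
  hom_ext rfl rfl rfl (Subtype.ext (Classical.choose_spec ((hΨ _ _).mp (Hom.unit ψ :).2)))

/-- `untrCompare` is full. [cite: MochizukiFrdI2008, Prop. 5.5 (iv) p.104] -/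
theorem untrCompare_full (hF : PreFrobenioid.IsFrobenioid (toElem Φ B DivB)) (hΨ : IsImageOfDivB Φ B DivB Ψ) : (untrCompare Ψ hF hΨ).Full where
  map_surjective {X Y} ψ :=
    ⟨(data Φ B DivB).toUntr.map
        (ObjectProperty.homMk (untrCompareLift Ψ hΨ (X := X.as.obj) (Y := Y.as.obj) ψ) :
          X.as ⟶ Y.as),
      untrCompareMap_lift Ψ hΨ (X := X.as) (Y := Y.as) ψ⟩

/-- `untrCompare` is surjective on objects: `(A_D, α)` is the image of the (isotropic) object
`(A_D, α)` of `C`. [cite: MochizukiFrdI2008, Prop. 5.5 (iv) p.104] -/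
theorem untrCompare_essSurj (hF : PreFrobenioid.IsFrobenioid (toElem Φ B DivB)) (hΨ : IsImageOfDivB Φ B DivB Ψ) (hBg : Objectwise (fun M _ => IsGroupLike M) B) :
    (untrCompare Ψ hF hΨ).EssSurj where
  mem_essImage Y :=
    ⟨(data Φ B DivB).toUntr.obj ⟨⟨Y.base, Y.cls⟩,
      (PreFrobenioidData.ofFunctor_isIsotropic (toElem Φ B DivB) _).mpr (isIsotropic hBg _)⟩,
      ⟨Iso.refl _⟩⟩

/-- **`untrCompare : C^un-tr ⥲ Ψ.ModelOf` is an equivalence of categories.**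
[cite: MochizukiFrdI2008, Prop. 5.5 (iv) p.104] -/
theorem untrCompare_isEquivalence (hF : PreFrobenioid.IsFrobenioid (toElem Φ B DivB)) (hΨ : IsImageOfDivB Φ B DivB Ψ) (hBg : Objectwise (fun M _ => IsGroupLike M) B) :
    (untrCompare Ψ hF hΨ).IsEquivalence where
  faithful := untrCompare_faithful Ψ hF hΨ
  full := untrCompare_full Ψ hF hΨ
  essSurj := untrCompare_essSurj Ψ hF hΨ hBg

/-- **Proposition 5.5 (iv), `C^un-tr`**: for the model Frobenioid `C` of `(Φ, B, Div_B)` (a Frobenioid,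
`hF`; `B` group-like, `hBg`) and the subfunctor of groups `Ψ = Div_B(B) ⊆ Φ^gp` (any `Ψ` with
`IsImageOfDivB`), "there is a natural equivalence of categories between `C^un-tr` and the model
Frobenioid associated to the data `Φ, Φ^birat, Φ^birat ↪ Φ^gp`", compatible with the functors to `F_Φ`.
[cite: MochizukiFrdI2008, Prop. 5.5 (iv) p.104] -/
theorem nonempty_untr_equivalence_modelOf (hF : PreFrobenioid.IsFrobenioid (toElem Φ B DivB)) (hΨ : IsImageOfDivB Φ B DivB Ψ)
    (hBg : Objectwise (fun M _ => IsGroupLike M) B) :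
    ∃ e : (data Φ B DivB).Untr ≌ Ψ.ModelOf,
      Nonempty (e.functor ⋙ toElem Φ Ψ.toMonoid Ψ.incl ≅ PreFrobenioid.untrFunctor hF) := by
  haveI := untrCompare_isEquivalence Ψ hF hΨ hBg
  exact ⟨(untrCompare Ψ hF hΨ).asEquivalence, ⟨eqToIso (untrCompare_comp_toElem Ψ hF hΨ)⟩⟩

end Compare

/-! ### The image of `Div_B` as a subfunctor of groups -/

variable (Φ B DivB) in
/-- `Φ^birat ⊆ Φ^gp`, "the image of `Div_B`" (Thm. 5.2 preamble p. 100), as a subfunctor of groups —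
for `B` group-like, so that the image is a subgroup. [cite: MochizukiFrdI2008, Thm. 5.2 p.100] -/
noncomputable def imageGpSubfunctor (hBg : Objectwise (fun M _ => IsGroupLike M) B) : GpSubfunctor Φ where
  carrier X :=
    { toSubmonoid := biratSubmonoid Φ B DivB (op X)
      inv_mem' := fun hx => inv_mem_biratSubmonoid (op X) (fun b => (hBg X).isUnit b) hx }
  pull_mem := by
    rintro X Y f c ⟨b, rfl⟩
    exact ⟨(B.map f.op).hom b, (pullGp_divB f b).symm⟩

/-- The image of `Div_B` is the image of `Div_B`. [cite: MochizukiFrdI2008, Thm. 5.2 p.100] -/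
theorem isImageOfDivB_imageGpSubfunctor (hBg : Objectwise (fun M _ => IsGroupLike M) B) :
    IsImageOfDivB Φ B DivB (imageGpSubfunctor Φ B DivB hBg) :=
  fun _ _ => Iff.rfl

/-- **Proposition 5.5 (iv), `C^un-tr`, at the image of `Div_B`**: `C^un-tr ≌ model(Φ, Div_B(B) ↪ Φ^gp)`
compatibly with the functors to `F_Φ`. [cite: MochizukiFrdI2008, Prop. 5.5 (iv) p.104] -/
theorem nonempty_untr_equivalence_image (hF : PreFrobenioid.IsFrobenioid (toElem Φ B DivB))
    (hBg : Objectwise (fun M _ => IsGroupLike M) B) :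
    ∃ e : (data Φ B DivB).Untr ≌ (imageGpSubfunctor Φ B DivB hBg).ModelOf,
      Nonempty (e.functor ⋙ toElem Φ _ _ ≅ PreFrobenioid.untrFunctor hF) :=
  nonempty_untr_equivalence_modelOf _ hF (isImageOfDivB_imageGpSubfunctor hBg) hBg

end ModelFrobenioid

end Literature.AlgebraicGeometry.Frobenioids
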